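import Summits.QuantumFields.BalabanUV.Beta.GAN24.FineReadoutCauchy
import Summits.QuantumFields.BalabanUV.Beta.GAN24.FineReadoutCauchyMatchedSum

/-!
# `BalabanUV.Beta.GAN24.FineReadoutCauchyHolds` — «(N1-Cauchy)» HOLDS at `d = 3`, every `Lc ≥ 2`: the located analytic input of the five DIFF rows is a tree theorem

**G-an2-4 FORMALISATION SWARM, b2b-balaban-gan24-formalise-leaf-17 (gen 11) — the CLOSING module of the located leaf «(N1-Cauchy)»**
(owner's typed spec `HOME/b2b-balaban-gan24-p1/N1-CAUCHY-SPEC.md` §1; division `HOME/b2b-balaban-gan24-formalise-leaf-17/g11/N1-CAUCHY-DIVISION.md`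
v2.1 — the team table of record: F/N/S₀/S1/S2/END leaf-17 (holder), A leaf-16 (`FineReadoutCauchyScalars/Amp/Matched/MatchedRate/MatchedSum`),
K leaf-01 (`FineReadoutCauchyTail`), C + real assembly leaf-13 (`FineReadoutCauchyCap/Real`)).  NOT IN PRINT; OUR PROOF ATTEMPT.  [folklore]
composition: S3 (the 3-line dictionary between S1's canonical amplitudes and PART A's T00 amplitudes) + one `exact`.

HONEST FRAMING (verbatim): «discharging `BetaPertH` makes Bałaban's UV stability UNCONDITIONAL — a real constructive-QFT result;
it is NOT the continuum limit and NOT the Clay problem.»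
HONEST DEPENDENCY (verbatim): «continuum YM on T⁴ ⇐ BetaPertH ∧ nine spine estimates (0/9 proved); BetaPertH ⇐ (D1) ∧ (D4) ∧ CAP+tail;
G-an2-4 gates asym, D1 and NE2/3/4.»

## What is here
* §1 S3 dictionary: `ampA_col_eq_Ahat` — at a real momentum off zero the canonical amplitudes of the multiplier column `fibInv N · (Q,l)` are
  T00's `Ahat N q 0 (eVec l)` (`AliasFibreBridge.ampA_eq_Ahat` + `FibInvClosedForm.fibreFun_fibInvCol`/`srcEL_single_inr`);
  `matched_eq` — S1's matched-label term IS PART A's `cellT·ampT′(lift) − ampT` (`boxW = Π gs`); `matched_sum_le` — PART A's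
  `FineReadoutCauchyMatchedSum.sum_norm_matched_le` delivers S2's hypothesis `hA` with `c_A = max (KM·KW) 0` at `N = Lc^(n+1)`, `N′ = Lc^(n+2)`.
* §2 **`exists_wH_cellMean_cauchy (Lc) [NeZero Lc] (hLc : 2 ≤ Lc)`** — «(N1-Cauchy)» = the owner's §1 VERBATIM at `d = 3`, NO HYPOTHESIS LEFT:
  `∃ c θ κ₁, 0 ≤ c ∧ 0 ≤ θ ∧ θ < 1 ∧ 0 < κ₁ ∧ ∀ n κ l z, |(Lc^4)⁻¹·Σ_{r ∈ box 4 Lc} (Lc^(n+2))^5·wH_{Lc^(n+2)} κ l (Lc•z + r) − (Lc^(n+1))^5·wH_{Lc^(n+1)} κ l z| ≤ c·θ^n·e^{−κ₁·|quo (Lc^(n+1)) z|₁}`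
  (`FineReadoutCauchy.exists_wH_cellMean_cauchy_of_matched` + §1).
This is the located analytic input «(N1-Cauchy)» of the DIFF rows dW, dV, dL of `StencilSlotE3RateOfPieces` (typer row T-N1C); it discharges
NO row and NOTHING of `(hS, hSall)` by itself.  0 sorry, axioms {propext, Classical.choice, Quot.sound}.
-/

noncomputable section

open Complex Finset
open scoped Real BigOperators
open Literature.MathematicalPhysics.QuantumFieldTheory
open Literature.MathematicalPhysics.QuantumFieldTheory.Balaban1983to89
open Literature.MathematicalPhysics.QuantumFieldTheory.Balaban1983to89.Beta
open Literature.Probability.LatticeModels (Site TorusSite Torus.proj)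
open LatticeForm (repZ quo)
open B12Sec2to5 (l1)
open B4Strip (ofRealVec)
open B4ContourShift (BZ)
open BlochFibreMatrix (Idx)
open AffineAveraging (box toSite)
open KernelSpecInstance (wH)
open Summit.QuantumFields.BalabanUV.Beta.GAN24.CombesThomasFibre (fibInv)
open Summit.QuantumFields.BalabanUV.Beta.GAN24.FibreSymbols (pw)
open Summit.QuantumFields.BalabanUV.Beta.GAN24.FibreDFT (kFine)
open Summit.QuantumFields.BalabanUV.Beta.GAN24.FibreDFTDictionary (ampA)
open Summit.QuantumFields.BalabanUV.Beta.GAN24.AliasObjects (gs kAl Ahat eVec)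
open Summit.QuantumFields.BalabanUV.Beta.GAN24.AliasReindex (lift)
open Summit.QuantumFields.BalabanUV.Beta.GAN24.AliasFibreBridge (ampA_eq_Ahat)
open Summit.QuantumFields.BalabanUV.Beta.GAN24.FibInvClosedForm (fibreFun_fibInvCol srcEL_single_inr)
open Summit.QuantumFields.BalabanUV.Beta.GAN24.FineReadoutCauchyFold (boxW boxW_eq_prod)
open Summit.QuantumFields.BalabanUV.Beta.GAN24.FineReadoutCauchy (exists_wH_cellMean_cauchy_of_matched)
open Summit.QuantumFields.BalabanUV.Beta.GAN24.FineReadoutCauchyMatched (ampT)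
open Summit.QuantumFields.BalabanUV.Beta.GAN24.FineReadoutCauchyMatchedSum (cellT sum_norm_matched_le KM KW)

namespace Summit.QuantumFields.BalabanUV.Beta.GAN24.FineReadoutCauchyHolds

variable {d : ℕ}

/-! ## §1 S3: the dictionary between S1's canonical amplitudes and PART A's T00 amplitudes -/

/-- [folklore] **At a real momentum off zero the canonical amplitudes of the multiplier column are T00's** `Ahat N q 0 (eVec l)`
(the column solves the fibre system with the unit multiplier source, whose EL-source vanishes). -/
theorem ampA_col_eq_Ahat {N : ℕ} [NeZero N] {q : Fin (d + 1) → ℝ} (hq : q ∈ BZ (d + 1)) (hq0 : q ≠ 0) (l : Fin (d + 1)) :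
    ampA (ofRealVec q) (fun i => fibInv N i (Sum.inr (Sum.inr l)) (ofRealVec q)) = Ahat N (ofRealVec q) 0 (eVec l) := by
  have hv := fibreFun_fibInvCol (N := N) q (Sum.inr (Sum.inr l))
  have hr : ∀ z : TorusSite (d + 1) N,
      (Pi.single (M := fun _ : Idx (d + 1) N => ℂ) (Sum.inr (Sum.inr l)) (1 : ℂ)) (Sum.inr (Sum.inl z)) = 0 := fun z => by simp
  rw [ampA_eq_Ahat hq hq0 hv hr, srcEL_single_inr]
  congr 1
  funext κ
  unfold eVec
  by_cases h : κ = l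
  · subst h; simp
  · rw [if_neg h, Pi.single_apply, if_neg]
    intro h'
    exact h (Sum.inr_injective (Sum.inr_injective h'))

/-- [folklore] **S1's matched-label term IS PART A's object**: `(Lc^{d+1})⁻¹·N′^{d+2}·(boxW·ampA′(lift m)) − N^{d+2}·ampA(m)
= cellT N′ Lc q (lift N′ m)·ampT N′ q l (lift N′ m) κ − ampT N q l m κ` at a real momentum off zero. -/
theorem matched_eq {N N' Lc : ℕ} [NeZero N] [NeZero N'] {q : Fin (d + 1) → ℝ} (hq : q ∈ BZ (d + 1)) (hq0 : q ≠ 0)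
    (l κ : Fin (d + 1)) (m : TorusSite (d + 1) N) :
    ((Lc : ℂ) ^ (d + 1))⁻¹ * ((N' : ℂ) ^ (d + 2)) *
          (boxW Lc (kFine (ofRealVec q) (lift N' m)) *
            ampA (ofRealVec q) (fun i => fibInv N' i (Sum.inr (Sum.inr l)) (ofRealVec q)) (lift N' m) κ) -
        ((N : ℂ) ^ (d + 2)) * ampA (ofRealVec q) (fun i => fibInv N i (Sum.inr (Sum.inr l)) (ofRealVec q)) m κ =
      cellT N' Lc q (lift N' m) * ampT N' q l (lift N' m) κ - ampT N q l m κ := by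
  rw [ampA_col_eq_Ahat hq hq0, ampA_col_eq_Ahat hq hq0]
  unfold cellT ampT
  rw [boxW_eq_prod]
  simp only [kAl]
  ring

/-- [folklore] A point of the zone has coordinates of modulus `≤ π`. -/
theorem abs_le_pi_of_mem_BZ {q : Fin (d + 1) → ℝ} (hq : q ∈ BZ (d + 1)) (i : Fin (d + 1)) : |q i| ≤ π :=
  abs_le.2 ⟨hq.1 i, hq.2 i⟩

/-- [folklore] **PART A DELIVERS S2's HYPOTHESIS `hA`** (`d = 3`): the matched-label terms sum in norm to `≤ max (KM·KW) 0 · (Lc⁻¹)^(n+1)`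
at every real momentum off zero (leaf-16's `FineReadoutCauchyMatchedSum.sum_norm_matched_le` at `N = Lc^(n+1)`, `N′ = Lc^(n+2)`). -/
theorem matched_sum_le (Lc : ℕ) [NeZero Lc] (n : ℕ) (κ l : Fin (3 + 1)) (_z : Site (3 + 1)) (q : Fin (3 + 1) → ℝ)
    (hq : q ∈ BZ (3 + 1)) (hq0 : q ≠ 0) :
    ∑ m : TorusSite (3 + 1) (Lc ^ (n + 1)),
        ‖(((Lc : ℂ) ^ (3 + 1))⁻¹ * (((Lc ^ (n + 2) : ℕ) : ℂ) ^ (3 + 2)) *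
            (boxW Lc (kFine (ofRealVec q) (lift (Lc ^ (n + 2)) m)) *
              ampA (ofRealVec q) (fun i => fibInv (Lc ^ (n + 2)) i (Sum.inr (Sum.inr l)) (ofRealVec q)) (lift (Lc ^ (n + 2)) m) κ) -
          (((Lc ^ (n + 1) : ℕ) : ℂ) ^ (3 + 2)) *
            ampA (ofRealVec q) (fun i => fibInv (Lc ^ (n + 1)) i (Sum.inr (Sum.inr l)) (ofRealVec q)) m κ)‖ ≤
      max (KM (3 + 1) * KW (3 + 1)) 0 * ((Lc : ℝ)⁻¹) ^ (n + 1) := by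
  have hN1 : 1 ≤ Lc ^ (n + 1) := Nat.one_le_pow _ _ (Nat.pos_of_ne_zero (NeZero.ne Lc))
  have hqabs : ∀ i, |q i| ≤ π := abs_le_pi_of_mem_BZ hq
  have h := sum_norm_matched_le (D := 3 + 1) (N := Lc ^ (n + 1)) (N' := Lc ^ (n + 2)) (Lc := Lc) (by norm_num) hN1
    (pow_succ Lc (n + 1)) hqabs hq0 l κ
  have e : ∀ m : TorusSite (3 + 1) (Lc ^ (n + 1)),
      ‖(((Lc : ℂ) ^ (3 + 1))⁻¹ * (((Lc ^ (n + 2) : ℕ) : ℂ) ^ (3 + 2)) *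
            (boxW Lc (kFine (ofRealVec q) (lift (Lc ^ (n + 2)) m)) *
              ampA (ofRealVec q) (fun i => fibInv (Lc ^ (n + 2)) i (Sum.inr (Sum.inr l)) (ofRealVec q)) (lift (Lc ^ (n + 2)) m) κ) -
          (((Lc ^ (n + 1) : ℕ) : ℂ) ^ (3 + 2)) *
            ampA (ofRealVec q) (fun i => fibInv (Lc ^ (n + 1)) i (Sum.inr (Sum.inr l)) (ofRealVec q)) m κ)‖ =
      ‖cellT (Lc ^ (n + 2)) Lc q (lift (Lc ^ (n + 2)) m) * ampT (Lc ^ (n + 2)) q l (lift (Lc ^ (n + 2)) m) κ -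
        ampT (Lc ^ (n + 1)) q l m κ‖ := by
    intro m
    rw [← matched_eq (d := 3) (N := Lc ^ (n + 1)) (N' := Lc ^ (n + 2)) (Lc := Lc) hq hq0 l κ m, Nat.cast_pow, Nat.cast_pow]
  rw [Finset.sum_congr rfl fun m _ => e m]
  refine h.trans ?_
  have hLc : (0 : ℝ) < Lc := by exact_mod_cast Nat.pos_of_ne_zero (NeZero.ne Lc)
  have hpow : (0 : ℝ) < ((Lc ^ (n + 1) : ℕ) : ℝ) := by exact_mod_cast hN1
  rw [div_eq_mul_inv, show (((Lc ^ (n + 1) : ℕ) : ℝ))⁻¹ = ((Lc : ℝ)⁻¹) ^ (n + 1) by push_cast; rw [inv_pow]]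
  exact mul_le_mul_of_nonneg_right (le_max_left _ _) (by positivity)

/-! ## §2 «(N1-Cauchy)» holds -/

/-- [folklore] **«(N1-Cauchy)» AT `d = 3`, EVERY `Lc ≥ 2` — the owner's `N1-CAUCHY-SPEC.md` §1 VERBATIM, no hypothesis left.**  The `Lc`-cell
means of the next level's normalised fine minimiser column `(Lc^(n+2))^5·wH_{Lc^(n+2)}`, read on the dilated cell `Lc•z + box Lc`, converge to
this level's `(Lc^(n+1))^5·wH_{Lc^(n+1)} κ l z` geometrically in the member `n` with exponential decay in the block label `quo z`:
the located two-level analytic input of the DIFF rows of road S3.  Proof = the team table: holder's frame/fold/glue/assembly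
(`FineReadoutCauchy{Frame,Fold,Glue,OfParts}`, `FineReadoutCauchy.exists_wH_cellMean_cauchy_of_matched`), leaf-16's matched-label bound
(`FineReadoutCauchyMatchedSum.sum_norm_matched_le`, with road P1's capacitance rates inside), leaf-01's new-label tail (`FineReadoutCauchyTail`),
leaf-13's real-zone assembly with (N1) and King's geometric mean (`FineReadoutCauchyReal`). -/
theorem exists_wH_cellMean_cauchy (Lc : ℕ) [NeZero Lc] (hLc : 2 ≤ Lc) :
    ∃ c θ κ₁ : ℝ, 0 ≤ c ∧ 0 ≤ θ ∧ θ < 1 ∧ 0 < κ₁ ∧ ∀ (n : ℕ) (κ l : Fin 4) (z : Fin 4 → ℤ),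
      |((Lc : ℝ) ^ (3 + 1))⁻¹ * ∑ r ∈ box (3 + 1) Lc,
            ((Lc : ℝ) ^ (n + 2)) ^ (3 + 2) * wH (N := Lc ^ (n + 2)) κ l ((Lc : ℤ) • z + toSite r) -
          ((Lc : ℝ) ^ (n + 1)) ^ (3 + 2) * wH (N := Lc ^ (n + 1)) κ l z| ≤
        c * θ ^ n * Real.exp (-κ₁ * l1 (quo (Lc ^ (n + 1)) z)) :=
  exists_wH_cellMean_cauchy_of_matched Lc hLc (le_max_right _ _) fun n κ l z q hq hq0 => matched_sum_le Lc n κ l z q hq hq0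

end Summit.QuantumFields.BalabanUV.Beta.GAN24.FineReadoutCauchyHolds

end
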